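import Summits.MatrixMultiplication.MatrixMultiplication.Theorems.AbelianSTPPCensusTAStatCDefs

/-!
# T_A certificate, third range `5667 … 6190` (static t*-indexed linear checker, free budget parameter): kernel evaluation, shape checks, volumes `5130 … 5879`

Cell mm-stpp (rung F-M1), threshold T_A = `τ = 2.371`; checker in `AbelianSTPPCensusTAStatCDefs.lean`, table in `AbelianSTPPCensusTAStatCData.lean`.
`decide` with kernel reduction (standard axioms; no `native_decide`), `Elab.async false`; consumed by `TAStatC.checkV_sound` / `TAStatC.domV_sound`
in the leaf `AbelianSTPPCensusLeafTA6190Closed.lean`.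
WHAT THIS IS NOT: arithmetic on shape lists only; no statement about STPP families or `ω`.
-/

set_option linter.dupNamespace false
set_option autoImplicit false
set_option Elab.async false

namespace Summit.MatrixMultiplication.MatrixMultiplication.Theorems.TAStatC

set_option maxHeartbeats 0 in
/-- Check chunk: every sorted candidate shape of the volumes `5130 … 5285` passes `checkShape` (44997 (shape, bucket) checks). [original] -/
theorem ck5130 : TAStatC.checkV 156 5130 = true := by decide +kernel

set_option maxHeartbeats 0 in
/-- Check chunk: every sorted candidate shape of the volumes `5286 … 5456` passes `checkShape` (44983 (shape, bucket) checks). [original] -/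
theorem ck5286 : TAStatC.checkV 171 5286 = true := by decide +kernel

set_option maxHeartbeats 0 in
/-- Check chunk: every sorted candidate shape of the volumes `5457 … 5641` passes `checkShape` (44596 (shape, bucket) checks). [original] -/
theorem ck5457 : TAStatC.checkV 185 5457 = true := by decide +kernel

set_option maxHeartbeats 0 in
/-- Check chunk: every sorted candidate shape of the volumes `5642 … 5879` passes `checkShape` (43781 (shape, bucket) checks). [original] -/
theorem ck5642 : TAStatC.checkV 238 5642 = true := by decide +kernel

end Summit.MatrixMultiplication.MatrixMultiplication.Theorems.TAStatC
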